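import Summits.CriticalPhenomena.PercolationContinuityZ3.Theorems.Transplant.KNCellsBoxProdZ2ConcReach
import Summits.CriticalPhenomena.PercolationContinuityZ3.Theorems.Transplant.KNCellsBoxProdZ2ChainRoom
import Summits.CriticalPhenomena.PercolationContinuityZ3.Theorems.Transplant.BoxProdZ2ConcKits
import HarnessLib

/-!
# Design (D), residue (C) part (iv) (lead's split 15:35:49Z): the KIT CLAUSES of the corridor chain of the concentric scheme — the
# concrete tube chain data `reachTCD` (window `B_X(w₀, E)`, rim parts `(B(w₀,E) \ B(w₀,E-L')) × region_i`), its subbox property under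
# `Wcor` exported (`isSubbox_reachTCD`), the level / width facts of the schedule, and **`hkits_reachTCD`**: the `hkits` hypothesis of
# `reachOblAt_concG` from p3-g2's kit providers (`kitClauseQ`, `hcon_tube`) with the planar room `TubeChainData.room` (`ℓ₁ = 6t`)

builds on p205010 (kernel theorem, internal audit signed; external expert review pending) — nothing in this file uses p205010.
Lane `prim-bschramm`, seat `prim-bschramm-p2` ((C)(iv) `hkits_concG`); helper file (`--supports stmt-CriticalPhenomena-4575`).

* `reachTCD` — the `TubeChainData` of the corridor chain of record; `reachTCD_Rim_subset`;
* `TubeChainData.level_subset_stepD` (levels `j ≤ j₁ ≤ Rlev`, `Rlev + 1 ≤ R'` lie in the region), `TubeChainData.wide` (every level `j ≥ M + 1`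
  of every core is at least `2M + 2` wide);
* `isSubbox_reachTCD` — `Wcor` is a subbox weighting of the tube graph on every region (the radius facts of `reachOblAt_concG`);
* **`hkits_reachTCD`** — `∀ i ≤ 86, ∀ j ∈ Icc j₀ j₁`, the kit clause of `ReachOblAt` / `reachOblAt_concG` for `reachTCD`, from the inputs at the
  running parameter (`hstd` at the kit scale `M`, `hlink` at the route scales `[ℓ₀, 6t]`), `M + 1 ≤ j₀`, `ψ(6t) + ψ(M) ≤ L' ≤ E`.
[cite: KozmaNitzan2024, §4 Lemma 10 (pp. 17–21), Lemma 11 (p. 22), Lemma 12 (pp. 23–25)]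
-/

noncomputable section

open MeasureTheory ProbabilityTheory
open scoped ENNReal Classical

namespace Summit.CriticalPhenomena.PercolationContinuityZ3.Theorems

namespace Transplant

namespace BoxProdZ2

open Literature.Probability.Percolation Literature.Probability.LatticeModels SimpleGraph GadgetSystem ProbeHistory HSiteScheme Contour KNCells
open Literature.Probability.Percolation.KozmaNitzan
open Literature.Probability.Percolation.KozmaNitzan.Cells (sgOf sgOf_sign)
open Literature.Probability.Percolation.GM
open Literature.Barriers.CriticalPhenomena (mem_graphBall_self)
open KNLevels ChainPlanar

variable {W : Type} [DecidableEq W] (X : SimpleGraph W) [X.LocallyFinite]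

/-! ## §1 The tube chain data of record -/

/-- **The corridor tube chain of the concentric scheme**: window `B_X(w₀, E)`, planar cells `C`, examined vertex `x`, direction `du`, schedule
constants `t R' Rlev N j₀ j₁`, source `(w₀, 0)`, support `Sfin`, rim parts `(B(w₀,E) \ B(w₀, E - L')) × region_i`.
[cite: KozmaNitzan2024, §4 Lemma 12 (pp. 23–25), p. 30] -/
def reachTCD (C : PCells) (w₀ : W) (E L' : ℕ) (x : Site 2) (du : MDir) (t R' Rlev N j₀ j₁ : ℕ) (Sfin : Finset (W × Site 2)) :
    TubeChainData W where
  π := ballFin X w₀ E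
  C := C
  x := x
  du := du
  t := t
  R' := R'
  Rlev := Rlev
  N := N
  j₀ := j₀
  j₁ := j₁
  root := (w₀, 0)
  Sfin := Sfin
  Rim := fun i => (ballFin X w₀ E \ ballFin X w₀ (E - L')) ×ˢ Sched.region t R' du.1 (sgOf du) (C.cen x) i

/-- The rim parts lie in the regions. [folklore] -/
theorem reachTCD_Rim_subset (C : PCells) (w₀ : W) (E L' : ℕ) (x : Site 2) (du : MDir) (t R' Rlev N j₀ j₁ : ℕ) (Sfin : Finset (W × Site 2))
    (i : ℕ) : (reachTCD X C w₀ E L' x du t R' Rlev N j₀ j₁ Sfin).Rim i ⊆ (reachTCD X C w₀ E L' x du t R' Rlev N j₀ j₁ Sfin).stepD i :=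
  Finset.product_subset_product_left Finset.sdiff_subset

/-! ## §2 Levels and widths of the schedule -/

namespace TubeChainData

omit [DecidableEq W] in
/-- **The levels `j ≤ j₁` of step `i` lie in its region** (`j₁ ≤ Rlev`, `Rlev + 1 ≤ R'`, `100 R' ≤ t`). [cite: KozmaNitzan2024, §4 Lemma 10 (p. 17: B⟨j⟩ ⊆ D)] -/
theorem level_subset_stepD (P : TubeChainData W) (hR : 100 * P.R' ≤ P.t) (hRl : P.Rlev + 1 ≤ P.R') (hj : P.j₁ ≤ P.Rlev) {i : ℕ}
    (hi : i ≤ Sched.nLast) {j : ℕ} (hjj : j ≤ P.j₁) : tubeLevel P.π (P.lo i) (P.hi i) j ⊆ P.π ×ˢ P.pregion i := by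
  rw [tubeLevel, TubeChainData.lo, TubeChainData.hi, sBox_enlarge _ _ (sgOf_sign P.du)]
  have hjR : (j : ℤ) ≤ P.R' := by exact_mod_cast (hjj.trans hj).trans (by omega : P.Rlev ≤ P.R')
  exact Finset.product_subset_product_right
    ((sBox_mono (sgOf_sign P.du) _ (by linarith) (by linarith) (by linarith)).trans
      (Sched.enlarge_core_subset_region (sgOf_sign P.du) _ hR hi))

omit [DecidableEq W] in
/-- **Every level `j ≥ M + 1` of every core is at least `2M + 2` wide in each coordinate** (the cores are nonempty boxes). [folklore] -/
theorem wide (P : TubeChainData W) (hR : 100 * P.R' ≤ P.t) {i : ℕ} (hi : i ≤ Sched.nLast) {M j : ℕ} (hMj : M + 1 ≤ j) :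
    ∀ k, (P.lo i - ((j : ℕ) : Site 2)) k + 2 * M + 2 ≤ (P.hi i + ((j : ℕ) : Site 2)) k := by
  intro k
  have hne := Sched.core_nonempty (sgOf_sign P.du) (P.C.cen P.x) hR (by omega : i ≤ Sched.nLast + 1) (t := P.t) (R' := P.R') (a := P.du.1)
  have hle : P.lo i ≤ P.hi i := Finset.nonempty_Icc.1 hne
  have hk := hle k
  have hMj' : (M : ℤ) + 1 ≤ j := by exact_mod_cast hMj
  simp only [Pi.sub_apply, Pi.add_apply, Pi.natCast_apply]
  linarith

end TubeChainData

/-! ## §3 The subbox property of the corridor law on the regions -/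

/-- **`Wcor` is a subbox weighting of the tube graph on every region of `reachTCD`** (the radius facts of `reachOblAt_concG`).
[cite: KozmaNitzan2024, §4 p. 17 (subbox), p. 31] -/
theorem isSubbox_reachTCD (C : PCells) (w₀ : W) {Λ : ConcRadiiG} (hΛ : Λ.WF C) {q : unitInterval} {δc : ℝ}
    {h : ProbeHistory (W × Site 2)} {e : Site 2 × MDir} (hV : (concSchemeG X C w₀ Λ q δc).Valid₂ (X □ zdGraph 2) h e)
    {a' : ℕ} {du : MDir} (hdu : du ∈ (concSchemeG X C w₀ Λ q δc).onward (X □ zdGraph 2) h (tgt e))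
    {E L' t R' Rlev N j₀ j₁ : ℕ} {Sfin : Finset (W × Site 2)}
    (hEQ : Λ.rQ ((concSchemeG X C w₀ Λ q δc).aOf₁ (X □ zdGraph 2) h e) (tgt e) = E) (hρ : ∀ ℓ, Λ.ρ a' (tgt e) du ℓ = E)
    (hB : Λ.rB ((concSchemeG X C w₀ Λ q δc).aOf₁ (X □ zdGraph 2) h e) e.1 e.2 ≤ E) (hEfar : E ≤ Λ.rE a' (tgt e) du)
    (hr : C.r = 4 * t) (hR : 100 * R' ≤ t) {i : ℕ} (hi : i ≤ Sched.nLast) :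
    KNLevels.IsSubbox (tubeGraph X (ballFin X w₀ E))
      ((concSchemeG X C w₀ Λ q δc).Wcor (X □ zdGraph 2) (faceDataCG X C w₀ Λ) h e ((concSchemeG X C w₀ Λ q δc).aOf₁ (X □ zdGraph 2) h e) a' du)
      q ((reachTCD X C w₀ E L' (tgt e) du t R' Rlev N j₀ j₁ Sfin).stepD i) := by
  set S := concSchemeG X C w₀ Λ q δc with hSdef
  set α := S.aOf₁ (X □ zdGraph 2) h e with hαdef
  set P := reachTCD X C w₀ E L' (tgt e) du t R' Rlev N j₀ j₁ Sfin with hP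
  have hL := levelGeomCG X C w₀ hΛ
  have hQ := qSepGeomCG X C w₀ Λ
  have hst : P.stepD i ⊆ P.π ×ˢ (P.C.Q P.x ∪ P.C.Hfull P.x P.du) := TubeChainData.stepD_subset hr hR hi
  -- the habitat containment
  have hab : P.stepD i ⊆ S.Γ.Q α (tgt e) ∪ S.Γ.Efar a' (tgt e) du := by
    intro v hv
    obtain ⟨hv1, hv2⟩ := Finset.mem_product.1 (hst hv)
    rcases Finset.mem_union.1 hv2 with hv2 | hv2
    · exact Finset.mem_union_left _ (Finset.mem_product.2 ⟨ballFin_mono X w₀ (le_of_eq hEQ.symm) hv1, hv2⟩)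
    · rcases Finset.mem_union.1 (C.Hfull_subset_Q_union_Efar (tgt e) du hv2) with hv3 | hv3
      · exact Finset.mem_union_left _ (Finset.mem_product.2 ⟨ballFin_mono X w₀ (le_of_eq hEQ.symm) hv1, hv3⟩)
      · exact Finset.mem_union_right _ (Finset.mem_product.2 ⟨ballFin_mono X w₀ hEfar hv1, hv3⟩)
  have hSx : P.stepD i ⊆ S.Sx (X □ zdGraph 2) h e α a' du := by
    intro v hv
    rcases Finset.mem_union.1 (hab hv) with hv | hv
    · exact Finset.mem_union_left _ (Finset.mem_union_right _ (Finset.mem_union_right _ hv))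
    · exact Finset.mem_union_right _ hv
  have hUc : P.stepD i ⊆ S.Ucor (X □ zdGraph 2) (faceDataCG X C w₀ Λ) h e α a' du := by
    intro v hv
    obtain ⟨hv1, hv2⟩ := Finset.mem_product.1 (hst hv)
    rcases Finset.mem_union.1 hv2 with hv2 | hv2
    · refine Finset.mem_union_left _ (Finset.mem_union_right _ (Finset.mem_union_right _ (Finset.mem_product.2 ⟨?_, hv2⟩)))
      exact ballFin_mono X w₀ (le_of_eq hEQ.symm) hv1
    · refine Finset.mem_union_right _ ?_
      change v ∈ stair X w₀ (fun t => Λ.ρ a' (tgt e) du (C.lev du (tgt e) t)) (C.Hfull (tgt e) du)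
      rw [mem_stair]
      exact ⟨hv2, ballFin_mono X w₀ (le_of_eq (hρ _).symm) hv1⟩
  refine KSchA.isSubbox_Wcor_tube X (ballFin X w₀ E) hL hQ hV hdu hab hSx hUc (fun u hu => (Finset.mem_product.1 hu).1)
    fun v hv x hx hadj => ?_
  exact tube_adj_of_mem_Ewv_Hfull (X := X) hB (le_of_eq hEQ) (fun ℓ => le_of_eq (hρ ℓ)) hx (Finset.mem_product.1 hv).1 hadj

/-! ## §4 The kit clauses from the inputs at the running parameter -/

/-- **THE KIT CLAUSES OF THE CORRIDOR CHAIN** (`hkits` of `reachOblAt_concG` for `reachTCD`): for every step `i ≤ 86` and level `j ∈ [j₀, j₁]`,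
p3-g2's `kitClauseQ` with the rim / deep dichotomy `hcon_tube` — the rooms from `TubeChainData.room` (route scales `ℓ ∈ [ℓ₀, 6t]`), the subbox
property from `isSubbox_reachTCD`. [cite: KozmaNitzan2024, §4 Lemma 10 (pp. 17–21), Lemma 11 (p. 22), Lemma 12 (pp. 23–25)] -/
theorem hkits_reachTCD [Countable W] (C : PCells) (w₀ : W) {Λ : ConcRadiiG} (hΛ : Λ.WF C) {q : unitInterval} {δc : ℝ}
    {h : ProbeHistory (W × Site 2)} {e : Site 2 × MDir} (hV : (concSchemeG X C w₀ Λ q δc).Valid₂ (X □ zdGraph 2) h e)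
    {a' : ℕ} {du : MDir} (hdu : du ∈ (concSchemeG X C w₀ Λ q δc).onward (X □ zdGraph 2) h (tgt e))
    {E L' t R' Rlev N j₀ j₁ : ℕ} (Sfin : Finset (W × Site 2))
    (hEQ : Λ.rQ ((concSchemeG X C w₀ Λ q δc).aOf₁ (X □ zdGraph 2) h e) (tgt e) = E) (hρ : ∀ ℓ, Λ.ρ a' (tgt e) du ℓ = E)
    (hB : Λ.rB ((concSchemeG X C w₀ Λ q δc).aOf₁ (X □ zdGraph 2) h e) e.1 e.2 ≤ E) (hEfar : E ≤ Λ.rE a' (tgt e) du)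
    (hr : C.r = 4 * t) (hR : 100 * R' ≤ t) (hRl : Rlev + 1 ≤ R') (hj : j₁ ≤ Rlev) {ℓ₀ : ℕ} (hℓ : R' + ℓ₀ ≤ t)
    {Δ : ℕ} (hΔ : ∀ w, X.degree w ≤ Δ) {p₀ : unitInterval} (hT : TubeSubcritical X p₀) (V₀ : Finset W) (hfr : ∀ w : W, ∃ γ : X ≃g X, γ w ∈ V₀)
    {δ : ℝ} (hδ : 0 < δ) {msel : W → ℕ} {M : ℕ} (hmsel : ∀ τ ∈ V₀, msel τ ≤ M)
    (hstd : ∀ τ ∈ V₀,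
      1 - δ ^ 2 < (bondPercolation (X □ zdGraph 2) q).real (UniqZone.zone (X □ zdGraph 2) (ufatSeq X hT V₀ τ) (msel τ) M) ∧
      ∀ g : HOct 2, 1 - δ ^ 2 < (bondPercolation (X □ zdGraph 2) q).real
        (linkIn (↑(ufatSeq X hT V₀ τ M)) (ufatSeq X hT V₀ τ (msel τ)) (ballFin X τ (ufatRadius X hT V₀ M) ×ˢ piece g M)))
    (hMℓ : M < ℓ₀)
    (hlink : ∀ ℓ, ℓ₀ ≤ ℓ → ℓ ≤ 6 * t → ∀ τ ∈ V₀, ∀ g : HOct 2, 1 - δ ^ 2 < (bondPercolation (X □ zdGraph 2) q).real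
      (linkIn (↑(ufatSeq X hT V₀ τ ℓ)) (ufatSeq X hT V₀ τ (msel τ)) (ballFin X τ (ufatRadius X hT V₀ ℓ) ×ˢ piece g ℓ)))
    (hnF : ufatRadius X hT V₀ M ≤ E) (hLψ : ufatRadius X hT V₀ (6 * t) + ufatRadius X hT V₀ M ≤ L') (hLE : L' ≤ E)
    (hj₀ : M + 1 ≤ j₀) (kk : ℕ) (hN : kk * kitB Δ M (ufatRadius X hT V₀ M) ≤ N) (hk : (1 - (q : ℝ) ^ kitSB Δ M (ufatRadius X hT V₀ M)) ^ kk ≤ δ) :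
    ∀ i ≤ Sched.nLast, ∀ j ∈ Finset.Icc j₀ j₁,
      ∃ (σ : KNLevels.SData (W × Site 2)) (Sz : Finset (W × Site 2)),
      KNLevels.SHyp (tubeLData X (reachTCD X C w₀ E L' (tgt e) du t R' Rlev N j₀ j₁ Sfin).π
        ((reachTCD X C w₀ E L' (tgt e) du t R' Rlev N j₀ j₁ Sfin).lo i) ((reachTCD X C w₀ E L' (tgt e) du t R' Rlev N j₀ j₁ Sfin).hi i)
        (reachTCD X C w₀ E L' (tgt e) du t R' Rlev N j₀ j₁ Sfin).root (reachTCD X C w₀ E L' (tgt e) du t R' Rlev N j₀ j₁ Sfin).Sfin) j σ ∧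
      σ.N ≤ (reachTCD X C w₀ E L' (tgt e) du t R' Rlev N j₀ j₁ Sfin).N ∧
      (1 - (q : ℝ) ^ σ.sB) ^ σ.k ≤ δ ∧
      Sz ⊆ (tubeLData X (reachTCD X C w₀ E L' (tgt e) du t R' Rlev N j₀ j₁ Sfin).π
        ((reachTCD X C w₀ E L' (tgt e) du t R' Rlev N j₀ j₁ Sfin).lo i) ((reachTCD X C w₀ E L' (tgt e) du t R' Rlev N j₀ j₁ Sfin).hi i)
        (reachTCD X C w₀ E L' (tgt e) du t R' Rlev N j₀ j₁ Sfin).root (reachTCD X C w₀ E L' (tgt e) du t R' Rlev N j₀ j₁ Sfin).Sfin).X j ∧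
      Sz ⊆ (reachTCD X C w₀ E L' (tgt e) du t R' Rlev N j₀ j₁ Sfin).stepD i ∧
      (∀ x ∈ σ.K, ∀ e' ∈ σ.seed x, e' ∉ wireSet (↑Sz : Set (W × Site 2))) ∧ (∀ x ∈ σ.K, σ.face x ⊆ Sz) ∧
      (∀ x ∈ σ.K, 1 - 3 * δ ≤ (prodBernoulli ((concSchemeG X C w₀ Λ q δc).Wcor (X □ zdGraph 2) (faceDataCG X C w₀ Λ) h e
          ((concSchemeG X C w₀ Λ q δc).aOf₁ (X □ zdGraph 2) h e) a' du)).real {ω | ∃ u ∈ σ.face x,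
        1 - δ < (prodBernoulli (pinW ((concSchemeG X C w₀ Λ q δc).Wcor (X □ zdGraph 2) (faceDataCG X C w₀ Λ) h e
          ((concSchemeG X C w₀ Λ q δc).aOf₁ (X □ zdGraph 2) h e) a' du) (wireSet (↑Sz : Set (W × Site 2))) ω)).real
          (⋃ z ∈ (reachTCD X C w₀ E L' (tgt e) du t R' Rlev N j₀ j₁ Sfin).tgtE i,
            openConnIn (↑((reachTCD X C w₀ E L' (tgt e) du t R' Rlev N j₀ j₁ Sfin).stepD i) : Set (W × Site 2)) u z)}) := by
  set P := reachTCD X C w₀ E L' (tgt e) du t R' Rlev N j₀ j₁ Sfin with hP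
  intro i hi j hjj
  have hj₁ : j ≤ j₁ := (Finset.mem_Icc.1 hjj).2
  have hjM : M + 1 ≤ j := hj₀.trans (Finset.mem_Icc.1 hjj).1
  have hwide := TubeChainData.wide P hR hi hjM
  have hWD : IsSubbox (tubeGraph X (ballFin X w₀ E)) _ q (ballFin X w₀ E ×ˢ P.pregion i) :=
    isSubbox_reachTCD X C w₀ hΛ hV hdu hEQ hρ hB hEfar hr hR hi
  have hXD : tubeLevel (ballFin X w₀ E) (P.lo i) (P.hi i) j ⊆ ballFin X w₀ E ×ˢ P.pregion i :=
    TubeChainData.level_subset_stepD P hR hRl hj hi hj₁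
  have hTpl : ballFin X w₀ E ×ˢ P.pcore (i + 1) ⊆ P.tgtE i := Finset.subset_union_left
  have hRimT : P.Rim i ⊆ P.tgtE i := Finset.subset_union_right
  have hRim : (ballFin X w₀ E \ ballFin X w₀ (E - L')) ×ˢ P.pregion i ⊆ P.Rim i := subset_rfl
  refine kitClauseQ X hΔ hT V₀ hδ hmsel hstd hnF hwide kk P.root P.Sfin hWD hXD hN hk fun x hx => ?_
  -- the planar room at the contact's cube centre: a route scale `ℓ ∈ [ℓ₀, 6t]`
  obtain ⟨ℓ, hℓ₀, hℓ₁, hroomD, a, τ', hroomT⟩ := TubeChainData.room P hR hRl hj hℓ hi j hj₁ _ (vctr_mem_level X hwide hx)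
  have hψ : ufatRadius X hT V₀ ℓ + ufatRadius X hT V₀ M ≤ L' := (Nat.add_le_add_right (ufatRadius_mono X hT V₀ hℓ₁) _).trans hLψ
  exact hcon_tube X hT V₀ hfr (lt_of_lt_of_le hMℓ hℓ₀) (hlink ℓ hℓ₀ hℓ₁) hnF hψ hLE hwide hWD hXD hTpl hRimT hRim hx hroomD hroomT

end BoxProdZ2

end Transplant

end Summit.CriticalPhenomena.PercolationContinuityZ3.Theorems

end
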